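import Summits.QuantumFields.QCD.Theorems.LightQuarkCompletion.Negative.Anatomy

/-!
# Crux `LightQuarkCompletion` (stmt-QuantumFields-18066, route NestedDissectionSea, rank 6), negative side —
# line `Sketch`, stub B2a: the "lower pin THROUGH the band" residual is false for every zero-pinned regularisation

Support file of the standing disprover (cycle 2, refuter-cdisprove-stmt-QuantumFields-18066-g2-0, 2026-08-17; extract of
`Cruxes/LightQuarkCompletion/Disproof.lean` §13).  NO refutation of the crux.  Sorry-free, standard axioms; the two `def`s are
statement abbreviations (the lead's residual goal and a hypothesis class); nothing asserts a Theses decl.  (The clash is re-derived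
inline so that this file depends on `Anatomy.lean` only; the general two-regularisation form is `PinClash.pin_clash`.)

TARGET (lead c1, crux NOTES `## Census`, stuck goal of `stub_jumpGerm`, reached through the landed reduction
`LightQuarkJumpLine.jumpGerm_of_bandLowerPin` with `φ = id`, `J = M₀`):

    ⊢ ∀ m : Fin Nf → ℝ, (∀ f, M₀ < m f) → ∃ R : ℝ, 0 < R ∧ PinClause Nf reg (-M₀) m R ∧ UpperPin Nf reg M₀ m R

i.e. the LOWER pin of the threshold regularisation `reg` continued THROUGH the band, up to RGI height `M₀` ABOVE its line.  This
postulates the germ at the TOP of the band (`J = M₀`).  But the germ is a datum of `reg`, anywhere in `[−M₀, M₀]`; whenever the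
parity-jump line of `reg` sits strictly below the top — e.g. `reg` is already pinned at zero threshold (`J = 0`), which by
monotonicity is a legitimate threshold-`M₀` package and physically the shape of the bridge's / the crux's own output — the band
lower pin asks `P ≥ 1/4` at heights in `(0, M₀)` where `reg`'s zero-threshold UPPER pin gives `P ≤ 1/8`:

* `bandLowerPin_clash` — `UpperPin Nf reg 0 m R₀` and `PinClause Nf reg (−M₀) m R` (`M₀ > 0`) clash as soon as `R < 2R₀`
  (at the common bare mass `m_crit + a (M₀/2)/Z_m` on a common odd torus of side in `[max R R₀, 2R₀]`);
* `not_bandLowerPin_of_allRadii` — if the zero-threshold upper pin of `reg` at the tuple `m` holds for ALL radii `≥ R₀`, the band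
  lower pin at `m` fails for EVERY radius;
* `bandLowerPinResidual_false_of` — hence the residual, read as a statement about ALL threshold-`M₀` packages (which is how the stub
  quantifies), is FALSE modulo `ZeroPinnedAllRadii Nf`: the existence of ONE zero-threshold package whose upper pin holds at all
  radii (believed TRUE — it is the physically expected form of the crux's own conclusion; not constructible here).

Moral for B2a: the germ must be LOCATED (`J = J(reg) ∈ [−M₀, M₀]`, band sharpening), not postulated at the top of the band; the
`J = M₀` reduction is a dead end except for regularisations whose jump line happens to be the top of their band.
-/

noncomputable section

open scoped BigOperators Classical
open MeasureTheory Filter Topology Matrix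
open Literature.MathematicalPhysics.QuantumLattice Literature.MathematicalPhysics.QuantumFieldTheory
  Literature.Probability.LatticeModels
open Summit.QuantumFields.QCD.Theses.NestedDissectionSea
open Summit.QuantumFields.QCD.Theorems.CoerciveSeaNegative
open Summit.QuantumFields.QCD.Theorems.EarlyCrosserLawNegative

namespace Summit.QuantumFields.QCD.Theorems.LightQuarkCompletion.Negative

variable {Nf : ℕ}

/-- **The band lower pin clashes with the zero-threshold upper pin of the same regularisation** (radius compatibility
`R < 2R₀`): depth `−M₀/2 > −M₀` of the band lower pin and height `M₀/2 > 0` of the upper pin are the same bare mass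
`m_crit + a (M₀/2)/Z_m`, with the same weights; eventually `2a_k ≤ 2R₀ − max R R₀`, so some odd torus side `a_k(2S+1)` lies in
`[max R R₀, 2R₀]` (least `S` above `max R R₀`), where the same ratio would be `≥ 1/4` and `≤ 1/8`. [folklore] -/
theorem bandLowerPin_clash {reg : QCDRegularisation Nf} {M₀ : ℝ} (hM₀ : 0 < M₀) {m : Fin Nf → ℝ} {R R₀ : ℝ}
    (hup : UpperPin Nf reg 0 m R₀) (hlo : PinClause Nf reg (-M₀) m R) (hR₀ : 0 < R₀) (hRR : R < 2 * R₀) : False := by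
  set ρ : ℝ := max R R₀ with hρ
  have hρpos : 0 < ρ := lt_max_of_lt_right hR₀
  have hρlt : ρ < 2 * R₀ := max_lt hRR (by linarith)
  have hsmall : ∀ᶠ k : ℕ in atTop, 2 * reg.a k ≤ 2 * R₀ - ρ := by
    have h2 : Tendsto (fun k => 2 * reg.a k) atTop (𝓝 0) := by simpa using reg.tendsto_a.const_mul 2
    exact h2.eventually (ge_mem_nhds (by linarith))
  have hM₁ : -M₀ < -M₀ / 2 := by linarith
  have hM₂ : (0 : ℝ) < M₀ / 2 := by linarith
  obtain ⟨k, hk₁, hk₂, hk₃⟩ := ((hlo (-M₀ / 2) hM₁).and ((hup (M₀ / 2) hM₂).and hsmall)).exists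
  -- a common odd torus: the least `S` with `ρ ≤ a_k (2S+1)`
  have ha := reg.a_pos k
  have hex : ∃ S : ℕ, ρ ≤ reg.a k * (2 * (S : ℝ) + 1) := by
    obtain ⟨n, hn⟩ := exists_nat_ge (ρ / reg.a k)
    refine ⟨n, ?_⟩
    rw [div_le_iff₀ ha] at hn
    nlinarith
  have hS₁ : ρ ≤ reg.a k * (2 * (Nat.find hex : ℝ) + 1) := Nat.find_spec hex
  have hS₂ : reg.a k * (2 * (Nat.find hex : ℝ) + 1) ≤ 2 * R₀ := by
    rcases Nat.eq_zero_or_pos (Nat.find hex) with h0 | hpos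
    · rw [h0]
      push_cast
      linarith
    · obtain ⟨n, hn⟩ : ∃ n : ℕ, Nat.find hex = n + 1 := ⟨Nat.find hex - 1, by omega⟩
      have hmin : ¬ ρ ≤ reg.a k * (2 * (n : ℝ) + 1) := Nat.find_min hex (by omega)
      rw [hn]
      push_cast
      nlinarith [not_le.mp hmin]
  have h1 := hk₁ (Nat.find hex) ((le_max_left _ _).trans hS₁)
  have h2 := hk₂ (Nat.find hex) ((le_max_right _ _).trans hS₁) hS₂
  have hμ : reg.mcrit k + reg.a k * (M₀ / 2) / reg.Zm k = reg.mcrit k - reg.a k * (-M₀ / 2) / reg.Zm k := by ring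
  simp only [hμ] at h2
  simp only at h1
  linarith

/-- **With an all-radii zero-threshold upper pin the band lower pin fails at every radius.** [folklore] -/
theorem not_bandLowerPin_of_allRadii {reg : QCDRegularisation Nf} {M₀ : ℝ} (hM₀ : 0 < M₀) {m : Fin Nf → ℝ} {R₀ : ℝ}
    (hR₀ : 0 < R₀) (hup : ∀ R', R₀ ≤ R' → UpperPin Nf reg 0 m R') (R : ℝ) : ¬ PinClause Nf reg (-M₀) m R := fun hlo =>
  bandLowerPin_clash hM₀ (hup (max R₀ R) (le_max_left _ _)) hlo (lt_max_of_lt_left hR₀)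
    (by have := le_max_right R₀ R; have := le_max_left R₀ R; linarith)

/-- **The lead's residual for B2a through `J = M₀`, universally over threshold-`M₀` packages** (`HypAt` of `Anatomy.lean`):
every threshold regularisation carries, at every tuple above `M₀`, the lower pin THROUGH the band together with its threshold
upper pin at a common radius.  Statement abbreviation; FALSE modulo `ZeroPinnedAllRadii`. -/
def BandLowerPinResidual (Nf : ℕ) (M₀ : ℝ) : Prop :=
  ∀ reg : QCDRegularisation Nf, HypAt Nf reg M₀ → ∀ m : Fin Nf → ℝ, (∀ f, M₀ < m f) →
    ∃ R : ℝ, 0 < R ∧ PinClause Nf reg (-M₀) m R ∧ UpperPin Nf reg M₀ m R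

/-- **H — a zero-threshold package whose upper pin holds at all radii**: some regularisation carries the hypothesis package at
threshold `0` and, at every positive tuple, the zero-threshold upper pin on `[R, 2R]` for EVERY `R ≥ R₀(m)`.  Believed TRUE (the
physically expected form of the crux's own conclusion: at fixed `R` the early-crosser count on tori of side `≤ 2R` vanishes as
`k → ∞`); not constructible here. [topic constructive-qft] -/
def ZeroPinnedAllRadii (Nf : ℕ) : Prop :=
  ∃ reg' : QCDRegularisation Nf, HypAt Nf reg' 0 ∧
    ∀ m : Fin Nf → ℝ, (∀ f, 0 < m f) → ∃ R₀ : ℝ, 0 < R₀ ∧ ∀ R', R₀ ≤ R' → UpperPin Nf reg' 0 m R'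

/-- **The `J = M₀` route to B2a is dead (modulo H).**  A zero-pinned all-radii regularisation is a threshold-`M₀` package for
every `M₀ > 0` (monotonicity of pin and body), and for it the band lower pin fails at every tuple and radius. [folklore] -/
theorem bandLowerPinResidual_false_of {M₀ : ℝ} (hM₀ : 0 < M₀) (H : ZeroPinnedAllRadii Nf) :
    ¬ BandLowerPinResidual Nf M₀ := by
  intro h
  obtain ⟨reg', ⟨hMS, hAS, hbr, -, hpin, hbody⟩, hall⟩ := H
  have hH : HypAt Nf reg' M₀ := ⟨hMS, hAS, hbr, hM₀.le, pinPkg_mono hpin hM₀.le, body_mono hbody hM₀.le⟩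
  obtain ⟨R, -, hlo, -⟩ := h reg' hH (fun _ => M₀ + 1) (fun _ => by linarith)
  obtain ⟨R₀, hR₀, hup⟩ := hall (fun _ => M₀ + 1) (fun _ => by linarith)
  exact not_bandLowerPin_of_allRadii hM₀ hR₀ hup R hlo

end Summit.QuantumFields.QCD.Theorems.LightQuarkCompletion.Negative

end
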